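import Summits.HodgeConjecture.HodgeConjecture.Theorems.F0P6aRGDAssemblyDefs          -- ★ K5-H1 home of the spine՚s definitions (P3 of ★ `…DefsLetters` p852776 → `…DefsInputs` → `…Defs`; was `Lines.F0_P6a_RGDAssembly`): `KottwitzΩ`
import Summits.HodgeConjecture.HodgeConjecture.Theorems.F0P6aPELWitnessE            -- ★ p850400 (the `Lines` E-line is its shim since K4): `mOf`, `PELWitnessE`, `IsCMTypeThrough`
import Summits.HodgeConjecture.HodgeConjecture.Theorems.F0P6aIsomSchemeFiniteType    -- ★ p850061 (the `Lines` SP3-a2 module is its shim since K4): `TupleIsoAt₂`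
import Summits.HodgeConjecture.HodgeConjecture.Theorems.F0P6aKottwitzAtOmegaOfComplexPoints       -- ★ p847344: Ω-points from ℂ-points
import Summits.HodgeConjecture.HodgeConjecture.Theorems.F0P6aKottwitzCountAtSplitPlace            -- ★ p847313: `exists_restrict`, `sum_filter_ker_residue_restrict_eq_one`
import Summits.HodgeConjecture.HodgeConjecture.Theorems.F0P6aKottwitzUnmixedFrame              -- ★ p847916 (ED. 2): `exists_cmType_adapted_unmixed`, `comp_mem_image_iff_of_unmixed`
import Literature.AlgebraicGeometry.AbelianSchemes.KottwitzCharpolyTransport                     -- ★ p847457: `kottwitz_iff_of_tupleIsoVia`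
import Literature.AlgebraicGeometry.AbelianSchemes.AbelianSchemeFixedPowBaseChange               -- ★ `RingAction.baseChange`
import HarnessLib

/-!
# `F0P6aStubKOTT` — ★ VERBATIM TWIN (K5-H3 prerequisite, promoted from K6 by LEAD F0P6-plan «M-140b»; RE-HOME TABLE v1.7 (LA7-plan (g7))) of the KOTT leaf `Lines/F0_P6a_StubKOTT.lean` ED. 2

**SIZE-LINT SPLIT ×2** (`Theorems/` files with proofs are ≤ 400 lines): parts `Theorems/F0P6aStubKOTTRows.lean` → `Theorems/F0P6aStubKOTT.lean`, each importing the previous, cut at declaration boundaries of `Lines/F0_P6a_StubKOTT.lean`; namespaces AND sections KEPT and re-opened per part (with their `open`∕`variable` lines replayed verbatim); the options preamble is repeated. This is PART 1.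

This `Theorems/` module is the TREE BYTES of `Summits/HodgeConjecture/HodgeConjecture/Cruxes/HLiu418/Lines/F0_P6a_StubKOTT.lean` (tree sha16 4594ebf9aa2bb03a, 573 l.; sorry-free, stub-free = class B of RE-HOME TABLE v1.7)
re-homed VERBATIM with the NAMESPACE KEPT (`Summit.HodgeConjecture.HodgeConjecture.Cruxes.HLiu418.F0P6aStubKOTT`), so every fully-qualified name of its 19 declarations is UNCHANGED
(0 FQN moves, 0 downstream bytes, 0 statement bytes).  The only edits are (a) this re-headed module docstring, (b) the `Lines` imports switched to their ★ homes (l.1 `Lines.F0_P6a_RGDAssembly` → `Theorems.F0P6aRGDAssemblyDefs`; l.2 `Lines.F0_P6a_PELWitnessE` → `Theorems.F0P6aPELWitnessE`; l.3 `Lines.F0_P6a_IsomSchemeFiniteType` → `Theorems.F0P6aIsomSchemeFiniteType`),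
and nothing else: this module has NO header-closed `def … : Prop` (every `def` carries binders), so the gate՚s `[cite:]`-relocation («STATE IT INLINE», LA-ref1 (g5) BOX K5 #R1)
does not touch it and every docstring below is byte-identical to the workfile՚s.

Why: the H3 hub twin ★ `F0P6aPELSpreadDefs` imports the P-LINE, whose ★ twin `F0P6aPELInputs` imports this module; a `Theorems/` file cannot import a `Lines/` workfile
(gate import fence; LAref-P (g5) BOX L4 #47, LEAD «M-140b»: H3 = SERIAL P-LANE ★ H1 Defs → ★ this → ★ P-LINE → ★ `PELSpreadDefs`).  After this file is ★ the `Lines`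
original becomes ED. 3 = SHIM (`import` of this module + `HarnessLib`), written in the SAME request as the P-LINE shim and the `PELSpread` hub edition so that no
environment ever holds two copies of a declaration.
HC_CM is proved only modulo the 7 printed citations (2 remaining: hLiu418 = stmt-HodgeConjecture-24832, h413 = stmt-HodgeConjecture-24833) until rung 0 closes; a re-home is count-neutral.

## Original module docstring (verbatim)
# `stub_KOTT` CLOSER SKELETON (HOME-only, A-p14 (g35), LEAD F0P6-plan (g3) «M-48»): the spine՚s `KottwitzΩ` row for the SPREAD tuple
# is the PURE TRANSPORT of the E-witness՚s `kottwitz` along the provenance `gen_iso` — shape (δ) of the census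

Cell `hodgecm-mathlib`, crux hLiu418 (stmt-HodgeConjecture-24832), P6 «MOD», P-line `stub_KOTT`.  HOME-only until the P-line v5 letter is written
(`Lines/F0_P6a_PELInputs.lean`); then `stub_KOTT := fun … T σ₀ hσ₀ hτE => kottwitzΩ_of_gen_iso … T.univ T.act T.dual T.pol T.lvl T.E.P.A T.E.ρ T.E.P.D
T.E.P.pol T.E.P.level T.τE T.Φ T.E.kottwitz T.gen_iso σ₀ hσ₀ hτE` (shape (δ)), or the same feeding the five-row letter with `m := fun τ => mOf ι₁ T.Φ (σ₀ ∘ τ)`,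
`τR := (exists_restrict w).choose`, `m_count := ★ p847313` under the Φ-adaptedness provenance (shapes (α)∕(β)).

INPUTS BY NAME, all ★: p847344 `charpoly_fibreHom_eq_prod_of_complexPoints_of_isGalois` + `exists_ringHom_comp_eq`; p847457
`AbelianSchemeOver.kottwitz_iff_of_tupleIsoVia`; ★ GaloisThickening `thickeningLift_embOfPoint_map_thickeningπ`, `thickeningLift_left_comp_snd`;
★ p847344 §3 `charpoly_cotangentMap_fibreHom_eq_baseChange` (`rfl`).  PROVENANCE REQUIRED beyond v4՚s `PELSpreadAt`: (K-prov-1) `τE ∘ algebraMap F Fi = ι₁`.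
HC_CM is proved only modulo the 2 remaining named inputs (hLiu418, h413) until rung 0 closes; count-neutral.
-/

set_option autoImplicit false

noncomputable section


namespace Summit.HodgeConjecture.HodgeConjecture.Cruxes.HLiu418.F0P6aStubKOTT

set_option linter.dupNamespace false  -- `Summit.HodgeConjecture.HodgeConjecture.…` BY DESIGN (D-0017)

open CategoryTheory CategoryTheory.Limits NumberField IsDedekindDomain MulAction AlgebraicGeometry
open scoped Matrix Polynomial Pointwise
open Literature.NumberTheory.GaloisRepresentations
open Literature.NumberTheory.Automorphic Literature.NumberTheory.Automorphic.UnitaryGroup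
open Literature.AlgebraicGeometry.ShimuraVarieties.UnitaryCanonicalModel
open Literature.NumberTheory.Automorphic.Liu2021.AppendixC
open Literature.AlgebraicGeometry.Motives (AlgPoints ComplexPoints IntegralModel SchemeOver thickening thickeningGalAction thickeningLift
  thickeningπ baseChange specOver)
open Literature.AlgebraicGeometry.Motives.AbelianVariety (cotangentMap bcSpec)
open Literature.AlgebraicGeometry.AbelianSchemes (AbelianSchemeOver)
open Literature.AlgebraicGeometry.AbelianSchemes.AbelianSchemeOver (fibreHom RingAction kottwitz_iff_of_tupleIsoVia)
open Literature.NumberTheory.DiophantineGeometry (geomResidueField specialFibreFunctor)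
open Literature.AlgebraicGeometry.RelativeSpec (ActionOver)
open Literature.NumberTheory.EllipticCurves (genericFibre)
open Summit.HodgeConjecture.HodgeConjecture.Cruxes.HLiu418.F0P6aModuliDatumDefs
open Summit.HodgeConjecture.HodgeConjecture.Cruxes.HLiu418.F0P6aRGDAssembly
open Summit.HodgeConjecture.HodgeConjecture.Cruxes.HLiu418.F0P6aPELWitnessE (PELWitnessE IsCMTypeThrough mOf)
open Summit.HodgeConjecture.HodgeConjecture.Cruxes.HLiu418.F0P6aIsomSchemeFiniteType (TupleIsoAt₂)
open Summit.HodgeConjecture.HodgeConjecture.Theorems.F0P6aKottwitzAtOmegaOfComplexPoints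
open Summit.HodgeConjecture.HodgeConjecture.Theorems.F0P6aKottwitzCountAtSplitPlace (exists_restrict sum_filter_ker_residue_restrict_eq_one
  exists_cmType_adapted)

/-- **ONE SHEET, ONE POINT** (the body of `KottwitzΩ` at `y = ℓ_{e′} y₀`, generic inclusion `ιη` abstracted): the E-side Kottwitz at the `Ω`-point
`ℓ_{e′} y₀` (★ p847344, exponents canonical for `F` Galois through `σ₀` over `ι₁`, using (K-prov-1) `τE ∘ algebraMap = ι₁`) transported to the spread tuple
along the isomorphism of tuples `hgen` (★ p847457 `kottwitz_iff_of_tupleIsoVia`), then read in the spine՚s `baseChange`∕`.i` currency (★ p847344 §3, `rfl`).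
[cite: Kottwitz1992, §5 pp. 389–391] [cite: RapoportSmithlingZhang2020Diagonal, §4.1 p. 17; Remark 3.6 (i) (3.14) p. 13] -/
theorem charpoly_eq_prod_of_tupleIsoAt₂ {F : Type} [Field F] [NumberField F] [IsCMField F] [IsGalois ℚ F] {ι₁ : F →+* ℂ}
    {Jstar : Matrix (Fin 2) (Fin 2) F}
    {K₀ : C5.OpenCompactSubgroup ↥(finAdelic ↥(maximalRealSubfield F) F (IsCMField.complexConj F) 2 Jstar)}
    (S : RecordSystemGS F Jstar ι₁ K₀) {Fi : Type} [Field Fi] [NumberField Fi] [Algebra F Fi] (Kc : C5.SmallLevel K₀)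
    (𝓜 : IntegralModel (𝓞 F) F ((thickening F Fi).obj (S.M.obj Kc))) (w : HeightOneSpectrum (𝓞 F))
    (univ : AbelianSchemeOver (𝓜.localise w).total.left) (act : RingAction (𝓞 F) univ) (dual : univ.DualPair)
    (pol : univ.Polarization dual) {g N : ℕ} (lvl : univ.LevelStructure g N)
    (A₂ : AbelianSchemeOver ((baseChange F Fi).obj (S.M.obj Kc)).left) (ρ₂ : RingAction (𝓞 F) A₂) (D₂ : A₂.DualPair)
    (pol₂ : A₂.Polarization D₂) (lvl₂ : A₂.LevelStructure g N)
    (τE : Fi →+* ℂ) (Φ : Set (F →+* ℂ))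
    (kottwitzE : letI : Algebra Fi ℂ := τE.toAlgebra
      ∀ (x : ComplexPoints ((baseChange F Fi).obj (S.M.obj Kc))) (b : 𝓞 F),
        haveI := ρ₂.isMonHom b
        (cotangentMap (A₂.fibre x.left).toAbelianVariety (fibreHom (ρ₂.i b) x.left)).charpoly =
          ∏ φ : F →+* ℂ, (Polynomial.X - Polynomial.C (φ (b : F))) ^ (mOf ι₁ Φ φ))
    (ιη : ((thickening F Fi).obj (S.M.obj Kc)).left ⟶ (𝓜.localise w).total.left)
    (e' : Fi →ₐ[F] AlgebraicClosure (w.adicCompletion F)) (y₀ : AlgPoints (S.M.obj Kc) (AlgebraicClosure (w.adicCompletion F)))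
    (hgen : TupleIsoAt₂ (thickeningLift e' (S.M.obj Kc) y₀).left
        (univ.baseChange ιη) (act.baseChange ιη) (dual.baseChange ιη) (pol.baseChange ιη) (lvl.baseChange ιη)
        A₂ ρ₂ D₂ pol₂ lvl₂)
    (σ₀ : AlgebraicClosure (w.adicCompletion F) →+* ℂ)
    (hσ₀ : σ₀.comp (algebraMap F (AlgebraicClosure (w.adicCompletion F))) = ι₁)
    (hτE : τE.comp (algebraMap F Fi) = ι₁) (b : 𝓞 F) :
    haveI := ((act.baseChange ιη).baseChange (thickeningLift e' (S.M.obj Kc) y₀).left).isMonHom_i b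
    (cotangentMap ((univ.baseChange ιη).baseChange (thickeningLift e' (S.M.obj Kc) y₀).left).toAffine.toAbelianVariety
        (InducedCategory.homMk
          (Grp.ofHom (A := ((univ.baseChange ιη).baseChange (thickeningLift e' (S.M.obj Kc) y₀).left).X)
            (B := ((univ.baseChange ιη).baseChange (thickeningLift e' (S.M.obj Kc) y₀).left).X)
            (((act.baseChange ιη).baseChange (thickeningLift e' (S.M.obj Kc) y₀).left).i b)))).charpoly =
      ∏ τ : (F →+* AlgebraicClosure (w.adicCompletion F)),
        (Polynomial.X - Polynomial.C (τ (b : F))) ^ (mOf ι₁ Φ (σ₀.comp τ)) := by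
  haveI := ((act.baseChange ιη).baseChange (thickeningLift e' (S.M.obj Kc) y₀).left).isMonHom_i b
  -- (k3b) the spine՚s `baseChange`∕`.i` LHS is the `fibre`∕`fibreHom` LHS (★ p847344 §3, `rfl`)
  refine (charpoly_cotangentMap_fibreHom_eq_baseChange (act.baseChange ιη) (thickeningLift e' (S.M.obj Kc) y₀).left b).symm.trans ?_
  -- (k3c) transport along the provenance isomorphism of tuples (★ p847457)
  obtain ⟨G, Ĝ, hG⟩ := hgen
  refine (Literature.AlgebraicGeometry.AbelianSchemes.AbelianSchemeOver.charpoly_cotangentMap_fibreHom_i_eq_of_tupleIsoVia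
    (thickeningLift e' (S.M.obj Kc) y₀).left (thickeningLift e' (S.M.obj Kc) y₀).left
    (act.baseChange ιη) ρ₂ (pol.baseChange ιη) pol₂ (lvl.baseChange ιη) lvl₂ hG b).trans ?_
  -- (k3d) the E-side: Kottwitz at the `Ω`-point `ℓ_{e′} y₀` from the `ℂ`-points over `τE` (★ p847344 HEAD, exponents canonical for `F` Galois)
  obtain ⟨σ, hσ⟩ := exists_ringHom_comp_eq F w Fi (e' : Fi →+* AlgebraicClosure (w.adicCompletion F)) τE
  have hσ' : σ₀.comp (algebraMap F (AlgebraicClosure (w.adicCompletion F))) =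
      σ.comp (algebraMap F (AlgebraicClosure (w.adicCompletion F))) := by
    rw [hσ₀, ← hτE, ← hσ, RingHom.comp_assoc, ← e'.comp_algebraMap]
  have hℂ : ∀ (t : Spec (.of ℂ) ⟶ ((baseChange F Fi).obj (S.M.obj Kc)).left),
      t ≫ ((baseChange F Fi).obj (S.M.obj Kc)).hom = Spec.map (CommRingCat.ofHom τE) → ∀ b : 𝓞 F,
        haveI := ρ₂.isMonHom b
        (cotangentMap (A₂.fibre t).toAbelianVariety (fibreHom (ρ₂.i b) t)).charpoly =
          ∏ φ : F →+* ℂ, (Polynomial.X - Polynomial.C (φ ((fun b : 𝓞 F => (b : F)) b))) ^ (mOf ι₁ Φ φ) := by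
    intro t ht b
    letI : Algebra Fi ℂ := τE.toAlgebra
    exact kottwitzE (Over.homMk t ht) b
  have ht : (thickeningLift e' (S.M.obj Kc) y₀).left ≫ ((baseChange F Fi).obj (S.M.obj Kc)).hom =
      Spec.map (CommRingCat.ofHom (e' : Fi →+* AlgebraicClosure (w.adicCompletion F))) :=
    Literature.AlgebraicGeometry.Motives.thickeningLift_left_comp_snd e' (S.M.obj Kc) y₀
  exact charpoly_fibreHom_eq_prod_of_complexPoints_of_isGalois ((baseChange F Fi).obj (S.M.obj Kc)).hom A₂ ρ₂
    (fun b : 𝓞 F => (b : F)) (e' : Fi →+* AlgebraicClosure (w.adicCompletion F)) τE σ (mOf ι₁ Φ) hσ hℂ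
    (algebraMap F (AlgebraicClosure (w.adicCompletion F))) σ₀ hσ' _ ht b

/-- **`KottwitzΩ` FOR THE SPREAD TUPLE IS THE TRANSPORT OF THE E-WITNESS՚S `kottwitz` ALONG `gen_iso`** (census shape (δ)): given the D1∕D-1 data
`univ act dual pol lvl` over `𝓨_(w)`, an E-side tuple `(A₂, ρ₂, D₂, pol₂, lvl₂)` over `(S.M Kc) ⊗_F Fᵢ` satisfying KOTTWITZ at the `ℂ`-points over `τE`
with exponents `mOf ι₁ Φ` (the `PELWitnessE.kottwitz` text), the pointwise provenance `gen_iso` (`TupleIsoAt₂` on every sheet at every record point), a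
complex embedding `σ₀` of `Ω = F̄_w` over `ι₁` and (K-prov-1) `τE ∘ algebraMap = ι₁`: the spine՚s row `KottwitzΩ S Kc 𝓜 w univ act (mOf ι₁ Φ ∘ (σ₀ ∘ ·))`.
[cite: Kottwitz1992, §5 pp. 389–391] [cite: RapoportSmithlingZhang2020Diagonal, §4.1 p. 17; Remark 3.6 (i) (3.14) p. 13] -/
theorem kottwitzΩ_of_gen_iso {F : Type} [Field F] [NumberField F] [IsCMField F] [IsGalois ℚ F] {ι₁ : F →+* ℂ}
    {Jstar : Matrix (Fin 2) (Fin 2) F}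
    {K₀ : C5.OpenCompactSubgroup ↥(finAdelic ↥(maximalRealSubfield F) F (IsCMField.complexConj F) 2 Jstar)}
    (S : RecordSystemGS F Jstar ι₁ K₀) {Fi : Type} [Field Fi] [NumberField Fi] [Algebra F Fi] (Kc : C5.SmallLevel K₀)
    (𝓜 : IntegralModel (𝓞 F) F ((thickening F Fi).obj (S.M.obj Kc))) (w : HeightOneSpectrum (𝓞 F))
    (univ : AbelianSchemeOver (𝓜.localise w).total.left) (act : RingAction (𝓞 F) univ) (dual : univ.DualPair)
    (pol : univ.Polarization dual) {g N : ℕ} (lvl : univ.LevelStructure g N)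
    (A₂ : AbelianSchemeOver ((baseChange F Fi).obj (S.M.obj Kc)).left) (ρ₂ : RingAction (𝓞 F) A₂) (D₂ : A₂.DualPair)
    (pol₂ : A₂.Polarization D₂) (lvl₂ : A₂.LevelStructure g N)
    (τE : Fi →+* ℂ) (Φ : Set (F →+* ℂ))
    (kottwitzE : letI : Algebra Fi ℂ := τE.toAlgebra
      ∀ (x : ComplexPoints ((baseChange F Fi).obj (S.M.obj Kc))) (b : 𝓞 F),
        haveI := ρ₂.isMonHom b
        (cotangentMap (A₂.fibre x.left).toAbelianVariety (fibreHom (ρ₂.i b) x.left)).charpoly =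
          ∏ φ : F →+* ℂ, (Polynomial.X - Polynomial.C (φ (b : F))) ^ (mOf ι₁ Φ φ))
    (gen_iso : ∀ (e' : Fi →ₐ[F] AlgebraicClosure (w.adicCompletion F))
      (y : AlgPoints (S.M.obj Kc) (AlgebraicClosure (w.adicCompletion F))),
      letI ιη := (𝓜.localise w).genericIso'.inv.left ≫
        pullback.fst (𝓜.localise w).total.hom
          (Literature.NumberTheory.EllipticCurves.specGenericPoint (HeightOneSpectrum.valuationSubringAtPrime F w) F)
      TupleIsoAt₂ (thickeningLift e' (S.M.obj Kc) y).left
        (univ.baseChange ιη) (act.baseChange ιη) (dual.baseChange ιη) (pol.baseChange ιη) (lvl.baseChange ιη)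
        A₂ ρ₂ D₂ pol₂ lvl₂)
    (σ₀ : AlgebraicClosure (w.adicCompletion F) →+* ℂ)
    (hσ₀ : σ₀.comp (algebraMap F (AlgebraicClosure (w.adicCompletion F))) = ι₁)
    (hτE : τE.comp (algebraMap F Fi) = ι₁) :
    KottwitzΩ S Kc 𝓜 w univ act (fun τ => mOf ι₁ Φ (σ₀.comp τ)) := by
  intro y b
  -- (k3a) every `Ω`-point of the thickened generic fibre lies on a sheet `e′`: `y = ℓ_{e′} y₀` (★ GaloisThickening)
  rw [← Literature.AlgebraicGeometry.Motives.thickeningLift_embOfPoint_map_thickeningπ (K := F) (L := Fi) (S.M.obj Kc) y]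
  exact charpoly_eq_prod_of_tupleIsoAt₂ S Kc 𝓜 w univ act dual pol lvl A₂ ρ₂ D₂ pol₂ lvl₂ τE Φ kottwitzE _ _ _ (gen_iso _ _) σ₀ hσ₀ hτE b

/-- **THE FIVE KOTTWITZ ROWS `m kottwitzΩ τR τR_spec m_count` OF THE SPINE FROM THE E-WITNESS** (census shapes (α)∕(β): the five-row letter of
«M-47 addendum» under the two provenance hypotheses (K-prov-1) `τE ∘ algebraMap = ι₁` and (K-prov-2) «`Φ` is `w`-adapted through `σ₀`»): `m := mOf ι₁ Φ ∘ (σ₀ ∘ ·)`,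
`τR` := ★ p847313 `exists_restrict`, `m_count` := ★ p847313 `sum_filter_ker_residue_restrict_eq_one` (arithmetic of `(F, w, Φ)`), `kottwitzΩ` := `kottwitzΩ_of_gen_iso`.
[cite: Kottwitz1992, §5 pp. 389–391] [cite: RapoportSmithlingZhang2020Diagonal, §4.1 (4.6) p. 16 and p. 17; Remark 3.6 (i) (3.14) p. 13] -/
theorem exists_kottwitzRows_of_gen_iso {F : Type} [Field F] [NumberField F] [IsCMField F] [IsGalois ℚ F] {ι₁ : F →+* ℂ}
    {Jstar : Matrix (Fin 2) (Fin 2) F}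
    {K₀ : C5.OpenCompactSubgroup ↥(finAdelic ↥(maximalRealSubfield F) F (IsCMField.complexConj F) 2 Jstar)}
    (S : RecordSystemGS F Jstar ι₁ K₀) {Fi : Type} [Field Fi] [NumberField Fi] [Algebra F Fi] (Kc : C5.SmallLevel K₀)
    (𝓜 : IntegralModel (𝓞 F) F ((thickening F Fi).obj (S.M.obj Kc))) (w : HeightOneSpectrum (𝓞 F))
    (hw : (IsCMField.complexConj F) • w ≠ w)
    (univ : AbelianSchemeOver (𝓜.localise w).total.left) (act : RingAction (𝓞 F) univ) (dual : univ.DualPair)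
    (pol : univ.Polarization dual) {g N : ℕ} (lvl : univ.LevelStructure g N)
    (A₂ : AbelianSchemeOver ((baseChange F Fi).obj (S.M.obj Kc)).left) (ρ₂ : RingAction (𝓞 F) A₂) (D₂ : A₂.DualPair)
    (pol₂ : A₂.Polarization D₂) (lvl₂ : A₂.LevelStructure g N)
    (τE : Fi →+* ℂ) (Φ : Set (F →+* ℂ))
    (kottwitzE : letI : Algebra Fi ℂ := τE.toAlgebra
      ∀ (x : ComplexPoints ((baseChange F Fi).obj (S.M.obj Kc))) (b : 𝓞 F),
        haveI := ρ₂.isMonHom b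
        (cotangentMap (A₂.fibre x.left).toAbelianVariety (fibreHom (ρ₂.i b) x.left)).charpoly =
          ∏ φ : F →+* ℂ, (Polynomial.X - Polynomial.C (φ (b : F))) ^ (mOf ι₁ Φ φ))
    (gen_iso : ∀ (e' : Fi →ₐ[F] AlgebraicClosure (w.adicCompletion F))
      (y : AlgPoints (S.M.obj Kc) (AlgebraicClosure (w.adicCompletion F))),
      letI ιη := (𝓜.localise w).genericIso'.inv.left ≫
        pullback.fst (𝓜.localise w).total.hom
          (Literature.NumberTheory.EllipticCurves.specGenericPoint (HeightOneSpectrum.valuationSubringAtPrime F w) F)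
      TupleIsoAt₂ (thickeningLift e' (S.M.obj Kc) y).left
        (univ.baseChange ιη) (act.baseChange ιη) (dual.baseChange ιη) (pol.baseChange ιη) (lvl.baseChange ιη)
        A₂ ρ₂ D₂ pol₂ lvl₂)
    (σ₀ : AlgebraicClosure (w.adicCompletion F) →+* ℂ)
    (hσ₀ : σ₀.comp (algebraMap F (AlgebraicClosure (w.adicCompletion F))) = ι₁)
    (hτE : τE.comp (algebraMap F Fi) = ι₁)
    (hΦw : ∀ (τR : (F →+* AlgebraicClosure (w.adicCompletion F)) → (𝓞 F →+* ↥(closureValuationSubring (w.adicCompletion F))))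
      (_ : ∀ (τ : F →+* AlgebraicClosure (w.adicCompletion F)) (x : 𝓞 F),
        ((τR τ x : ↥(closureValuationSubring (w.adicCompletion F))) : AlgebraicClosure (w.adicCompletion F)) = τ (x : F))
      (τ : F →+* AlgebraicClosure (w.adicCompletion F)),
      RingHom.ker ((IsLocalRing.residue ↥(closureValuationSubring (w.adicCompletion F))).comp (τR τ)) =
        ((IsCMField.complexConj F) • w).asIdeal →
      τ ≠ ((algebraMap (w.adicCompletion F) (AlgebraicClosure (w.adicCompletion F))).comp (algebraMap F (w.adicCompletion F))).comp
        ((IsCMField.complexConj F : F ≃ₐ[↥(maximalRealSubfield F)] F) : F →+* F) →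
      σ₀.comp τ ∈ Φ) :
    ∃ (m : (F →+* AlgebraicClosure (w.adicCompletion F)) → ℕ)
      (τR : (F →+* AlgebraicClosure (w.adicCompletion F)) → (𝓞 F →+* ↥(closureValuationSubring (w.adicCompletion F)))),
      (∀ (τ : F →+* AlgebraicClosure (w.adicCompletion F)) (x : 𝓞 F),
        ((τR τ x : ↥(closureValuationSubring (w.adicCompletion F))) : AlgebraicClosure (w.adicCompletion F)) = τ (x : F)) ∧
      (∑ τ ∈ (Finset.univ.filter fun τ : F →+* AlgebraicClosure (w.adicCompletion F) =>
          RingHom.ker ((IsLocalRing.residue ↥(closureValuationSubring (w.adicCompletion F))).comp (τR τ)) =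
            (((IsCMField.complexConj F) • w).asIdeal : Ideal (𝓞 F))), m τ = 1) ∧
      KottwitzΩ S Kc 𝓜 w univ act m := by
  classical
  obtain ⟨τR, hτR⟩ := exists_restrict w
  refine ⟨fun τ => mOf ι₁ Φ (σ₀.comp τ), τR, hτR, ?_,
    kottwitzΩ_of_gen_iso S Kc 𝓜 w univ act dual pol lvl A₂ ρ₂ D₂ pol₂ lvl₂ τE Φ kottwitzE gen_iso σ₀ hσ₀ hτE⟩
  -- the structural embedding `τ_w` goes to `ι₁` under `σ₀`, and `τ_w ∘ c` to `ῑ₁`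
  have hτw : σ₀.comp ((algebraMap (w.adicCompletion F) (AlgebraicClosure (w.adicCompletion F))).comp
      (algebraMap F (w.adicCompletion F))) = ι₁ := by
    rw [← IsScalarTower.algebraMap_eq]; exact hσ₀
  have hτwc : σ₀.comp (((algebraMap (w.adicCompletion F) (AlgebraicClosure (w.adicCompletion F))).comp
      (algebraMap F (w.adicCompletion F))).comp ((IsCMField.complexConj F : F ≃ₐ[↥(maximalRealSubfield F)] F) : F →+* F)) =
      ComplexEmbedding.conjugate ι₁ := by
    rw [← RingHom.comp_assoc, hτw]
    ext x
    change ι₁ (IsCMField.complexConj F x) = _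
    rw [IsCMField.complexEmbedding_complexConj, ComplexEmbedding.conjugate_coe_eq]
  have hinj : ∀ τ τ' : F →+* AlgebraicClosure (w.adicCompletion F), σ₀.comp τ = σ₀.comp τ' → τ = τ' :=
    fun τ τ' h => RingHom.ext fun x => σ₀.injective (RingHom.congr_fun h x)
  refine sum_filter_ker_residue_restrict_eq_one w τR hτR hw (Finset.univ.filter fun τ => σ₀.comp τ ∈ Φ) _ ?_ ?_ ?_
  · intro τ hτ hne
    exact Finset.mem_filter.mpr ⟨Finset.mem_univ _, hΦw τR hτR τ hτ hne⟩
  · show mOf ι₁ Φ _ = 1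
    rw [hτwc]
    simp only [mOf, or_true, if_true]
  · intro τ hτ hne hnec
    have h₁ : σ₀.comp τ ≠ ι₁ := fun h => hne (hinj _ _ (h.trans hτw.symm))
    have h₂ : σ₀.comp τ ≠ ComplexEmbedding.conjugate ι₁ := fun h => hnec (hinj _ _ (h.trans hτwc.symm))
    show mOf ι₁ Φ _ = 0
    simp only [mOf, h₁, h₂, or_self, if_false, (Finset.mem_filter.mp hτ).2, if_true]

/-- **PROPOSED PROVENANCE TEXT (K-prov-2) `KottAdaptedAt ι₁ w Φ` — «the frame `Φ` is ADAPTED to the split place `w`»**, in the tokens of ★ p847313 (so that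
the SPREAD constructor pays it by ★ `exists_cmType_adapted` pushed forward along a complex embedding of `F̄_w` over `ι₁`, and the `stub_KOTT` closer feeds it to
★ `sum_filter_ker_residue_restrict_eq_one` with NO bridge on either side): for every restriction family `τR` (unique), every `σ : F̄_w →+* ℂ` over `ι₁` (its
values on `F`-embeddings are canonical for `F` Galois, ★ `comp_eq_comp_of_isGalois`) and every `τ : F →+* F̄_w` inducing `c • w` other than `τ_w ∘ c`, the complex
partner `σ ∘ τ` lies in `Φ`.  (Desk ∕ ref1-g8 (K-a)∕(K-b): this `def` body, or its Galois-intrinsic twin, is the text of the field ∕ hypothesis `hΦw`.)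
[cite: RapoportSmithlingZhang2020Diagonal, §4.1 (4.6) p. 16 and p. 17; §3.1 p. 8; §4.1 (4.7)–(4.8) p. 16] [cite: Kottwitz1992, §5 p. 390] -/
def KottAdaptedAt {F : Type} [Field F] [NumberField F] [IsCMField F] (ι₁ : F →+* ℂ) (w : HeightOneSpectrum (𝓞 F))
    (Φ : Set (F →+* ℂ)) : Prop :=
  ∀ (τR : (F →+* AlgebraicClosure (w.adicCompletion F)) → (𝓞 F →+* ↥(closureValuationSubring (w.adicCompletion F)))),
    (∀ (τ : F →+* AlgebraicClosure (w.adicCompletion F)) (x : 𝓞 F),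
      ((τR τ x : ↥(closureValuationSubring (w.adicCompletion F))) : AlgebraicClosure (w.adicCompletion F)) = τ (x : F)) →
    ∀ (σ : AlgebraicClosure (w.adicCompletion F) →+* ℂ),
      σ.comp ((algebraMap (w.adicCompletion F) (AlgebraicClosure (w.adicCompletion F))).comp (algebraMap F (w.adicCompletion F))) = ι₁ →
      ∀ τ : F →+* AlgebraicClosure (w.adicCompletion F),
        RingHom.ker ((IsLocalRing.residue ↥(closureValuationSubring (w.adicCompletion F))).comp (τR τ)) =
          ((IsCMField.complexConj F) • w).asIdeal →
        τ ≠ ((algebraMap (w.adicCompletion F) (AlgebraicClosure (w.adicCompletion F))).comp (algebraMap F (w.adicCompletion F))).comp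
          ((IsCMField.complexConj F : F ≃ₐ[↥(maximalRealSubfield F)] F) : F →+* F) →
        σ.comp τ ∈ Φ

/-- **`PELKottLawAt … T` FROM THE TWO PROVENANCE ROWS (shape (K-b) of F0P5a-ref1 (g8) n6 ∕ census (β))**: under (K-prov-1) `τE ∘ algebraMap = ι₁` and (K-prov-2)
`KottAdaptedAt ι₁ w Φ`, the five Kottwitz rows `∃ m τR, τR_spec ∧ m_count ∧ KottwitzΩ …` hold for the spread tuple — `σ₀` over `ι₁` is CHOSEN here (★ p847344 §1
`exists_ringHom_comp_eq` at `Fᵢ := F`), then `exists_kottwitzRows_of_gen_iso`.  With v6a՚s `T : PELSpreadAt …`, `stub_KOTT … T hτE hΦw` closes by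
`exact pelKottLaw_of_gen_iso S Kc 𝓜 w hw T.univ T.act T.dual T.pol T.lvl T.E.P.A T.E.ρ T.E.P.D T.E.P.pol T.E.P.level T.τE T.Φ T.E.kottwitz T.gen_iso hτE hΦw`
(the conclusion IS the body of `PELKottLawAt … T`, v6a :216, token for token). [cite: Kottwitz1992, §5 pp. 389–391]
[cite: RapoportSmithlingZhang2020Diagonal, §4.1 (4.6) p. 16 and p. 17; Remark 3.6 (i) (3.14) p. 13] -/
theorem pelKottLaw_of_gen_iso {F : Type} [Field F] [NumberField F] [IsCMField F] [IsGalois ℚ F] {ι₁ : F →+* ℂ}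
    {Jstar : Matrix (Fin 2) (Fin 2) F}
    {K₀ : C5.OpenCompactSubgroup ↥(finAdelic ↥(maximalRealSubfield F) F (IsCMField.complexConj F) 2 Jstar)}
    (S : RecordSystemGS F Jstar ι₁ K₀) {Fi : Type} [Field Fi] [NumberField Fi] [Algebra F Fi] (Kc : C5.SmallLevel K₀)
    (𝓜 : IntegralModel (𝓞 F) F ((thickening F Fi).obj (S.M.obj Kc))) (w : HeightOneSpectrum (𝓞 F))
    (hw : (IsCMField.complexConj F) • w ≠ w)
    (univ : AbelianSchemeOver (𝓜.localise w).total.left) (act : RingAction (𝓞 F) univ) (dual : univ.DualPair)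
    (pol : univ.Polarization dual) {g N : ℕ} (lvl : univ.LevelStructure g N)
    (A₂ : AbelianSchemeOver ((baseChange F Fi).obj (S.M.obj Kc)).left) (ρ₂ : RingAction (𝓞 F) A₂) (D₂ : A₂.DualPair)
    (pol₂ : A₂.Polarization D₂) (lvl₂ : A₂.LevelStructure g N)
    (τE : Fi →+* ℂ) (Φ : Set (F →+* ℂ))
    (kottwitzE : letI : Algebra Fi ℂ := τE.toAlgebra
      ∀ (x : ComplexPoints ((baseChange F Fi).obj (S.M.obj Kc))) (b : 𝓞 F),
        haveI := ρ₂.isMonHom b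
        (cotangentMap (A₂.fibre x.left).toAbelianVariety (fibreHom (ρ₂.i b) x.left)).charpoly =
          ∏ φ : F →+* ℂ, (Polynomial.X - Polynomial.C (φ (b : F))) ^ (mOf ι₁ Φ φ))
    (gen_iso : ∀ (e' : Fi →ₐ[F] AlgebraicClosure (w.adicCompletion F))
      (y : AlgPoints (S.M.obj Kc) (AlgebraicClosure (w.adicCompletion F))),
      letI ιη := (𝓜.localise w).genericIso'.inv.left ≫
        pullback.fst (𝓜.localise w).total.hom
          (Literature.NumberTheory.EllipticCurves.specGenericPoint (HeightOneSpectrum.valuationSubringAtPrime F w) F)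
      TupleIsoAt₂ (thickeningLift e' (S.M.obj Kc) y).left
        (univ.baseChange ιη) (act.baseChange ιη) (dual.baseChange ιη) (pol.baseChange ιη) (lvl.baseChange ιη)
        A₂ ρ₂ D₂ pol₂ lvl₂)
    (hτE : τE.comp (algebraMap F Fi) = ι₁) (hΦw : KottAdaptedAt ι₁ w Φ) :
    ∃ (m : (F →+* AlgebraicClosure (w.adicCompletion F)) → ℕ)
      (τR : (F →+* AlgebraicClosure (w.adicCompletion F)) → (𝓞 F →+* ↥(closureValuationSubring (w.adicCompletion F)))),
      (∀ (τ : F →+* AlgebraicClosure (w.adicCompletion F)) (x : 𝓞 F),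
        ((τR τ x : ↥(closureValuationSubring (w.adicCompletion F))) : AlgebraicClosure (w.adicCompletion F)) = τ (x : F)) ∧
      (∑ τ ∈ (Finset.univ.filter fun τ : F →+* AlgebraicClosure (w.adicCompletion F) =>
          RingHom.ker ((IsLocalRing.residue ↥(closureValuationSubring (w.adicCompletion F))).comp (τR τ)) =
            (((IsCMField.complexConj F) • w).asIdeal : Ideal (𝓞 F))), m τ = 1) ∧
      KottwitzΩ S Kc 𝓜 w univ act m := by
  -- `σ₀ : F̄_w →+* ℂ` over `ι₁` (★ p847344 §1 at `Fᵢ := F`)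
  obtain ⟨σ₀, hσ₀'⟩ := exists_ringHom_comp_eq F w F
    ((algebraMap (w.adicCompletion F) (AlgebraicClosure (w.adicCompletion F))).comp (algebraMap F (w.adicCompletion F))) ι₁
  have hσ₀ : σ₀.comp (algebraMap F (AlgebraicClosure (w.adicCompletion F))) = ι₁ := by
    rw [IsScalarTower.algebraMap_eq F (w.adicCompletion F) (AlgebraicClosure (w.adicCompletion F))]; exact hσ₀'
  exact exists_kottwitzRows_of_gen_iso S Kc 𝓜 w hw univ act dual pol lvl A₂ ρ₂ D₂ pol₂ lvl₂ τE Φ kottwitzE gen_iso σ₀ hσ₀ hτE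
    (fun τR hτR τ hτ hne => hΦw τR hτR σ₀ hσ₀' τ hτ hne)

end Summit.HodgeConjecture.HodgeConjecture.Cruxes.HLiu418.F0P6aStubKOTT
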